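import Mathlib
import Summits.KontsevichZagierPeriods.Zeta5Search.Elimination.HalfShiftBridge
import HarnessLib

/-!
# The half-shift BRIDGE without the rank condition `cas3 ≠ 0` (cell `pub-zeta5`, seat ct-1 g23)

HONEST FRAMING: systematic search; no irrationality claim unless certified — identities among the rational Taylor data
`D(b) = (U(b), W(b), V(b))` of the Ball–Rivoal family (the cell's dictionary); nothing about sizes, `ζ(5)` or irrationality;
no `def`, no new node.

fam-elim g23's `Elimination.HalfShiftBridge.halfShiftBridge_casUW/UV/VW` prove the ρ-free four-term BRIDGE
`A·d·X(DSz) + λ·pr·X(Hz) = λ·A·B₀·X(z) + π_T·d·X(z+e₇)` (each slot-7 wedge coordinate `X ∈ {U∧W, U∧V, V∧W}`) under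
`Q·pr·cas3(z) ≠ 0`: the proof expands bivectors in the basis `D(z), D(z+e₇), D(z+2e₇)` of `ℚ³`, which needs the rank
condition `cas3(z) ≠ 0`.  That condition FAILS exactly where the induction for the wide residual of `wedgeDictionaryFull`
needs the bridge most (ct-1 g23, INBOX l.9031): at the clusters with a non-edge pair sum `> z₀` (the pole-order drop gives
`U ≡ 0` there, so `cas3 = 0`).

This file removes the rank condition.  The bridge is a FORMAL consequence of the three box-wide LINEAR relations among the
coefficient vectors — fam-elim's (DS) `D(DSz) = D(z+e₇) − λ·D(z)` (`dictionary_dsShift7`), the MEET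
`D₀·D(z+e₇) − A·D(z) = P·D(Hz) + Q·D(Hz+e₇)` (`dictMeet_at`) and the RAISE `pr·D(Hz) = Θ₁D(z) + Θ₂D(z+e₇) + Θ₃D(z+2e₇)`
(`dictRaise_at`) — together with the scalar identities `A = D₀λ + π_T` (`meetA_eq_lam`), `Θ₁ = A·q`, `Θ₃ = d·Q`,
`Θ₂ = Q·B₃ − D₀·q` (`raiseTh2_compact`), `B₃ = B₀ − λ′d` (`raiseB3_eq`): expanding the four wedges BILINEARLY in the pairs
`D(z)∧D(z+e₇)`, `D(z)∧D(z+2e₇)`, `D(z+e₇)∧D(z+2e₇)` (no basis property used), the three coefficient polynomials vanish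
identically.  So only `Q = meetQ(z) ≠ 0` and `pr ≠ 0` are needed (to un-multiply), and `z₇ + 1 ≤ z₀` instead of `z₇ + 2 ≤ z₀`:

* `bridge_formal` — the scalar skeleton (one `linear_combination` per step);
* **`halfShiftBridge_formal`** — the ρ-free bridge for all three coordinates, for `z` in the box with `d(z) ≥ 1`, `z₇ + 1 ≤ z₀`,
  `meetQ z ≠ 0`, `raisePr z ≠ 0` — in particular on the vanishing strata (`U ≡ 0`), where fam-elim's version is silent.
-/

open Finset

namespace Summit.KontsevichZagierPeriods.Zeta5Search.Elimination

open Summit.KontsevichZagierPeriods.Zeta5Search.DualSeries (InBox)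
open Summit.KontsevichZagierPeriods.Zeta5Search.WedgeDictionary

/-! ### 1. The scalar skeleton -/

/-- **The bridge is a formal consequence of RAISE, MEET and (DS).**  Components `φ, ψ` of two linear coordinates of the
seven vectors `D(z), D(z+e₇), D(z+2e₇)` (`φ₁,φ₂,φ₃`), `D(Hz), D(Hz+e₇)` (`φH, φH'`), `D(DSz), D(DSz+e₇)` (`φD, φD'`); the
hypotheses are the two coordinates of RAISE (`hRφ`, `hRψ`), MEET (`hMφ`, `hMψ`), (DS) at `z` and at `z+e₇`, and the scalar
identities; the conclusion is the ρ-free bridge for the wedge coordinate `X(x) = φ(x)ψ(x+e₇) − φ(x+e₇)ψ(x)`, given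
`Q ≠ 0`, `pr ≠ 0`. [folklore] -/
theorem bridge_formal {pr Q P D0 A lam lam' piT d q Th1 Th2 Th3 B0 B3
    φ1 φ2 φ3 φH φH' φD φD' ψ1 ψ2 ψ3 ψH ψH' ψD ψD' : ℚ}
    (hRφ : Th1 * φ1 + Th2 * φ2 + Th3 * φ3 - pr * φH = 0) (hRψ : Th1 * ψ1 + Th2 * ψ2 + Th3 * ψ3 - pr * ψH = 0)
    (hMφ : D0 * φ2 - A * φ1 - P * φH - Q * φH' = 0) (hMψ : D0 * ψ2 - A * ψ1 - P * ψH - Q * ψH' = 0)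
    (hDφ : φD = φ2 - lam * φ1) (hDψ : ψD = ψ2 - lam * ψ1) (hD'φ : φD' = φ3 - lam' * φ2) (hD'ψ : ψD' = ψ3 - lam' * ψ2)
    (hTh1 : Th1 = A * q) (hTh3 : Th3 = d * Q) (hA : A = D0 * lam + piT) (hΘ : Th2 = Q * B3 - D0 * q)
    (hB : B3 = B0 - lam' * d) (hQ : Q ≠ 0) (hpr : pr ≠ 0) :
    A * d * (φD * ψD' - φD' * ψD) + lam * pr * (φH * ψH' - φH' * ψH) =
      lam * A * B0 * (φ1 * ψ2 - φ2 * ψ1) + piT * d * (φ2 * ψ3 - φ3 * ψ2) := by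
  subst hDφ hDψ hD'φ hD'ψ hTh1 hTh3
  -- `pr·Q·X(Hz)` through RAISE and MEET (the `P`-term drops: `pr·φH·ψH − φH·pr·ψH = 0`)
  have e1 : pr * Q * (φH * ψH' - φH' * ψH) =
      (A * q * φ1 + Th2 * φ2 + d * Q * φ3) * (D0 * ψ2 - A * ψ1 - P * ψH) -
        (D0 * φ2 - A * φ1 - P * φH) * (A * q * ψ1 + Th2 * ψ2 + d * Q * ψ3) := by
    linear_combination (-(Q * ψH')) * hRφ + (-(A * q * φ1 + Th2 * φ2 + d * Q * φ3)) * hMψ + (pr * ψH) * hMφ +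
      (D0 * φ2 - A * φ1 - P * φH) * hRψ
  have e2 : (A * q * φ1 + Th2 * φ2 + d * Q * φ3) * ψH - φH * (A * q * ψ1 + Th2 * ψ2 + d * Q * ψ3) = 0 := by
    linear_combination ψH * hRφ - φH * hRψ
  -- the multiplied bridge is a formal identity
  have key : Q * pr * (A * d * ((φ2 - lam * φ1) * (ψ3 - lam' * ψ2) - (φ3 - lam' * φ2) * (ψ2 - lam * ψ1)) +
      lam * pr * (φH * ψH' - φH' * ψH) - (lam * A * B0 * (φ1 * ψ2 - φ2 * ψ1) + piT * d * (φ2 * ψ3 - φ3 * ψ2))) = 0 := by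
    linear_combination (lam * pr) * e1 - (lam * pr * P) * e2 + (Q * pr * d * (φ2 * ψ3 - φ3 * ψ2)) * hA +
      (lam * pr * A * Q * (φ1 * ψ2 - φ2 * ψ1)) * hB + (lam * pr * A * (φ1 * ψ2 - φ2 * ψ1)) * hΘ
  have h := (mul_eq_zero.1 key).resolve_left (mul_ne_zero hQ hpr)
  linear_combination h

/-! ### 2. The half-shift bridge without `cas3 ≠ 0` -/

/-- **The ρ-free half-shift BRIDGE without the rank condition.**  For `z` in the box with `d(z) ≥ 1`, `z₇ + 1 ≤ z₀`,
`meetQ z ≠ 0` and `raisePr z ≠ 0`:  `A·d·X(DSz) + λ·pr·X(Hz) = λ·A·B₀·X(z) + π_T·d·X(z+e₇)` for each slot-7 wedge coordinate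
`X ∈ {casUW, casUV, casVW}` — the statement of fam-elim's `halfShiftBridge_casUW/UV/VW` with the hypothesis `cas3 z ≠ 0` REMOVED
(and `z₇ + 2 ≤ z₀` relaxed to `z₇ + 1 ≤ z₀`).  Valid in particular on the vanishing strata (`U ≡ 0`, `cas3 = 0`). [folklore] -/
theorem halfShiftBridge_formal (z : ℕ → ℤ) (hz : InBox z) (hd : 1 ≤ dOf z) (h7 : z 7 + 1 ≤ z 0)
    (hQ : meetQ z ≠ 0) (hpr : raisePr z ≠ 0) :
    (meetA z * raiseD z * casUW (dsShift z) + dsLam z 6 * raisePr z * casUW (hShift z) =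
        dsLam z 6 * meetA z * bridgeB0 z * casUW z + raisePiT z * raiseD z * casUW (bump z 6)) ∧
      (meetA z * raiseD z * casUV (dsShift z) + dsLam z 6 * raisePr z * casUV (hShift z) =
          dsLam z 6 * meetA z * bridgeB0 z * casUV z + raisePiT z * raiseD z * casUV (bump z 6)) ∧
        (meetA z * raiseD z * casVW (dsShift z) + dsLam z 6 * raisePr z * casVW (hShift z) =
            dsLam z 6 * meetA z * bridgeB0 z * casVW z + raisePiT z * raiseD z * casVW (bump z 6)) := by
  have hb1 : InBox (bump z 6) := inBox_bump6 z hz (by omega)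
  have hd1 : dOf (bump z 6) = dOf z - 1 := dOf_bump z (mem_range.2 (by norm_num))
  -- the three linear relations, all coordinates
  obtain ⟨⟨RU, RW⟩, RV⟩ := dictRaise_at z hz hd h7
  obtain ⟨⟨MU, MW⟩, MV⟩ := dictMeet_at z hz (by omega) (by omega)
  obtain ⟨dU0, dW0, dV0⟩ := dictionary_dsShift7 z hz (by omega) (by omega)
  obtain ⟨dU1, dW1, dV1⟩ :=
    dictionary_dsShift7 (bump z 6) hb1 (by rw [hd1]; omega) (by rw [bump6_seven, bump_zero]; omega)
  -- the scalar identities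
  have hA := meetA_eq_lam z
  have hΘ := raiseTh2_compact z
  have hB := raiseB3_eq z
  have hTh1 : raiseTh1 z = meetA z * raiseQ z (-((z 7 : ℚ) + 1)) := rfl
  have hTh3 : raiseTh3 z = raiseD z * meetQ z := rfl
  refine ⟨?_, ?_, ?_⟩
  · unfold casUW
    rw [bump_dsShift]
    exact bridge_formal RU RW MU MW dU0 dW0 dU1 dW1 hTh1 hTh3 hA hΘ hB hQ hpr
  · unfold casUV
    rw [bump_dsShift]
    exact bridge_formal RU RV MU MV dU0 dV0 dU1 dV1 hTh1 hTh3 hA hΘ hB hQ hpr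
  · unfold casVW
    rw [bump_dsShift]
    exact bridge_formal RV RW MV MW dV0 dW0 dV1 dW1 hTh1 hTh3 hA hΘ hB hQ hpr

/-- **The half-shift bridge on the whole box, packaged**: for `z` in the box with `d(z) ≥ 1`, `z₇ + 1 ≤ z₀` and the six pair
sums over the slots `{1,2,3,6}` at most `z₀` (then `meetQ z ≠ 0` and `raisePr z > 0`), the three coordinates of the ρ-free bridge
hold — fam-elim's `halfShiftBridge` required ALL 21 pair sums `≤ z₀` and `z₇ + 2 ≤ z₀`. [folklore] -/
theorem halfShiftBridge_box (z : ℕ → ℤ) (hz : InBox z) (hd : 1 ≤ dOf z) (h7 : z 7 + 1 ≤ z 0)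
    (h12 : z 1 + z 2 ≤ z 0) (h13 : z 1 + z 3 ≤ z 0) (h16 : z 1 + z 6 ≤ z 0) (h23 : z 2 + z 3 ≤ z 0)
    (h26 : z 2 + z 6 ≤ z 0) (h36 : z 3 + z 6 ≤ z 0) :
    (meetA z * raiseD z * casUW (dsShift z) + dsLam z 6 * raisePr z * casUW (hShift z) =
        dsLam z 6 * meetA z * bridgeB0 z * casUW z + raisePiT z * raiseD z * casUW (bump z 6)) ∧
      (meetA z * raiseD z * casUV (dsShift z) + dsLam z 6 * raisePr z * casUV (hShift z) =
          dsLam z 6 * meetA z * bridgeB0 z * casUV z + raisePiT z * raiseD z * casUV (bump z 6)) ∧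
        (meetA z * raiseD z * casVW (dsShift z) + dsLam z 6 * raisePr z * casVW (hShift z) =
            dsLam z 6 * meetA z * bridgeB0 z * casVW z + raisePiT z * raiseD z * casVW (bump z 6)) := by
  have hQ : meetQ z ≠ 0 := meetQ_ne_zero z (by omega)
  have e12 : (0 : ℚ) < (z 0 : ℚ) + 1 - z 1 - z 2 := by
    have : ((z 1 : ℤ) : ℚ) + z 2 ≤ z 0 := by exact_mod_cast h12
    linarith
  have e13 : (0 : ℚ) < (z 0 : ℚ) + 1 - z 1 - z 3 := by
    have : ((z 1 : ℤ) : ℚ) + z 3 ≤ z 0 := by exact_mod_cast h13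
    linarith
  have e16 : (0 : ℚ) < (z 0 : ℚ) + 1 - z 1 - z 6 := by
    have : ((z 1 : ℤ) : ℚ) + z 6 ≤ z 0 := by exact_mod_cast h16
    linarith
  have e23 : (0 : ℚ) < (z 0 : ℚ) + 1 - z 2 - z 3 := by
    have : ((z 2 : ℤ) : ℚ) + z 3 ≤ z 0 := by exact_mod_cast h23
    linarith
  have e26 : (0 : ℚ) < (z 0 : ℚ) + 1 - z 2 - z 6 := by
    have : ((z 2 : ℤ) : ℚ) + z 6 ≤ z 0 := by exact_mod_cast h26
    linarith
  have e36 : (0 : ℚ) < (z 0 : ℚ) + 1 - z 3 - z 6 := by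
    have : ((z 3 : ℤ) : ℚ) + z 6 ≤ z 0 := by exact_mod_cast h36
    linarith
  have hpr : raisePr z ≠ 0 := by
    unfold raisePr
    positivity
  exact halfShiftBridge_formal z hz hd h7 hQ hpr

end Summit.KontsevichZagierPeriods.Zeta5Search.Elimination
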